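import Summits.QuantumAdvantage.QuantumAdvantage.Theorems.CubicForrelationNearExactIsExactTwelveLevelFiveR1RadicalAt2932
import Summits.QuantumAdvantage.QuantumAdvantage.Theorems.CubicForrelationNearExactIsExactTwelveLevelFiveR2abDeadAt2932

/-!
# Crux `CubicForrelation.NearExactIsExact` (stmt-QuantumAdvantage-14043) — n = 12 AT `Φ = 29/32`: the rigid level-5 configuration R1 is
  DEAD; a level-5 side at `Φ ≥ 29/32` is in configuration (c)

Certificate seat `b2b-cforr-cert` (gen 23).  HONEST FRAMING: kernel-checked finite-slice lemmas (standard axioms) about cubic Boolean pairs on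
12 bits: the last configuration with the residual supported on the odd hyperplane (`tw22_levelFive_ge2932_rigid`) is excluded, so together
with `tw23_levelFive_ge2932_offP_c` a side `g` with `W_g = 32u'`, some `u'` odd and `Φ(f,g) ≥ 29/32` has `e/2` odd somewhere off its
odd hyperplane (configuration (c): `e = ±2` on a 256-point set).  Whether `29/32` is a value of `Φ` for cubic pairs on 12 bits is NOT
decided here; NO new value of `θ₁₂`; NOT summit progress.  Paper proof: HOME/b2b-cforr-cert-g23/PROOF-N12-928-L5.md §7 (vi)–(vii).

THE ARGUMENT (`tw23_levelFive_R1_false`).  By `r1_frame` / `r1_structure` the `−3`-set is a coset `T = t₀ ⊕ R` of the radical `R`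
(`#R = 128`) of the alternating form of `D` inside `V`.  Character sums: `Ŝ(y)² = 2048·S_R(y)` (`gr20_Shat_sq`) and `S_R(y)² =
128·S_R(y)` (`gr20_SR_sq`) give `Ŝ(y) = Σ_{x∈P} σ(x)(−1)^{x·y} ∈ {0, ±512}`, and likewise `T̂(y) = ±S_R^{t₀}(y) ∈ {0, ±128}`.  Since
`e = σ − 4σ·1_T` on `P` and `e = 0` off `P`, `ê = Ŝ − 4T̂ ∈ 512ℤ`; by duality (`l5k_duality`, partner at level `≥ 5` by
`tw23_ge2932_levelFive`) `e_f = −ê/64 ∈ 8ℤ`.  Then `W_f = 32(e_f + 2s_g) = 64s_g + 256k` and Parseval `Σ W_f² = 2²⁴` give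
`Σ_y k(2k + s_g) = 0` with every term `≥ 0`, so `k ≡ 0`, `e_f ≡ 0`, `ê ≡ 0`, `e ≡ 0` (Walsh inversion) — but `e² ≥ 1` on `P`.

References: MacWilliams–Sloane (1977) Ch. 15 §2; C. Carlet (2020) §2.3, §5.2; R. O'Donnell (2014) §1.4.  Axioms: the standard three.
-/

set_option linter.dupNamespace false -- D-0017: single-problem summit ⇒ `QuantumAdvantage.QuantumAdvantage` by design

noncomputable section

namespace Summit.QuantumAdvantage.QuantumAdvantage.Theorems.CubicForrelation.NearExactIsExact

open Finset
open Literature.Computability.QuantumComplexity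
open Literature.Computability.QuantumComplexity.BuzetChailloux (bxor zeroVec bxor_bxor_cancel_left bxor_zeroVec zeroVec_bxor bxor_comm
  bxor_self)
open Literature.Computability.QuantumComplexity.DerivativeWalsh (W)
open Literature.Computability.QuantumComplexity.BuzetChailloux (twist_bxor_right signOf_sq)
open Literature.Computability.QuantumComplexity.DerivativeWalsh (twist_bxor_left sum_W_sq)
open Literature.Computability.QuantumComplexity.Simon (twist_eq_one_or)

/-! ### Configuration R1 is dead -/

/-- **Configuration R1 is DEAD.**  There is no cubic pair `f, g : 𝔽₂¹² → 𝔽₂` with `W_g = 32u'`, some `u'(x)` odd, `Φ(f,g) ≥ 29/32` and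
`u' = 2(−1)^f` at every even point of `u'` (residual supported on the odd hyperplane).  NOT summit progress. [this work] -/
theorem tw23_levelFive_R1_false (f g : (Fin (6 + 6) → Bool) → Bool) (hf : IsDegLeFun 3 f) (hg : IsDegLeFun 3 g)
    (u' : (Fin (6 + 6) → Bool) → ℤ) (hu' : ∀ x, W (fun y => signOf (g y)) x = (2 : ℝ) ^ 5 * (u' x : ℝ))
    (hodd : ∃ x, Odd (u' x)) (hΦ : (29 / 32 : ℝ) ≤ forrelation f g)
    (hoff : ∀ y, ¬ Odd (u' y) → u' y = 2 * sZ (f y)) : False := by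
  classical
  obtain ⟨γ, tg, D, htg, -, hP, hD, hvals, hT, -⟩ := tw22_levelFive_ge2932_rigid f g hf hg u' hu' hodd hΦ hoff
  obtain ⟨V, xP, x', h0, hadd, hcardV, hS, hS', hPcard, -, hP1, -, -, -⟩ := l5c_setup f g hg u' hu' hodd hΦ
  -- a frame, a point of `T`, and the structure `T = t₀ ⊕ R`, `#R = 128`
  obtain ⟨a₀, ha₀, a₁, ha₁, a₂, ha₂, a₃, ha₃, hPf⟩ := r1_frame f g hf hg u' hu' V xP x' h0 hadd hS hS' hoff hcardV D hD hvals hT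
  obtain ⟨t₀, ht₀⟩ : (univ.filter fun x : Fin (6 + 6) → Bool => Odd (u' x) ∧ u' x - 2 * sZ (f x) = -3 * sZ (D x)).Nonempty := by
    rw [← card_pos, hT]; norm_num
  have ht₀' := (mem_filter.1 ht₀).2
  obtain ⟨hRcard, hTeq⟩ := r1_structure f g hf hg u' hu' V xP x' h0 hadd hS hS' hoff hcardV hPcard D hD hvals hT ha₀ ha₁ ha₂ ha₃ hPf t₀ ht₀'
  set R := (V.filter fun r => ∀ v ∈ V, (D zeroVec ^^ D r ^^ D v ^^ D (bxor r v)) = false) with hR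
  set Pset := univ.filter (fun x : Fin (6 + 6) → Bool => Odd (u' x)) with hPset
  set e : (Fin (6 + 6) → Bool) → ℤ := fun x => u' x - 2 * sZ (f x) with hedef
  -- membership descriptions for the character-sum lemmas
  have hPmem : ∀ x, x ∈ Pset ↔ twist γ x = tg := fun x => by
    rw [hPset, mem_filter]; simp only [mem_univ, true_and]; exact hP x
  have hVmem : ∀ a, a ∈ V ↔ twist γ a = 1 := by
    intro a
    rw [l5k_memV u' V xP x' h0 hadd hS hS' a]
    constructor
    · intro h
      obtain ⟨x₁, hx₁⟩ := hodd
      rcases twist_eq_one_or γ a with h1 | h1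
      · exact h1
      · exfalso
        have h2 := (h x₁).2 hx₁
        rw [hP] at h2 hx₁
        rw [twist_bxor_right, hx₁, h1] at h2
        rcases htg with ht | ht <;> rw [ht] at h2 <;> norm_num at h2
    · intro h x
      rw [hP, hP, twist_bxor_right, h, mul_one]
  have hxP : xP ∈ Pset := by rw [hS]; exact mem_image.2 ⟨zeroVec, h0, bxor_zeroVec _⟩
  have hPV : ∀ x ∈ Pset, ∀ v ∈ V, bxor x v ∈ Pset := fun x hx v hv => by
    rw [hS] at hx ⊢; exact fl1_coset_vadd hadd rfl hx hv
  have hinjt : ∀ a ∈ R, ∀ b ∈ R, bxor t₀ a = bxor t₀ b → a = b := fun a _ b _ h => by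
    have h' := congrArg (bxor t₀) h
    rwa [bxor_bxor_cancel_left, bxor_bxor_cancel_left] at h'
  -- `ê(y) ∈ 512ℤ`
  have key : ∀ y, ∃ m : ℤ, ∑ a, ((e a : ℤ) : ℝ) * twist a y = 512 * (m : ℝ) := by
    intro y
    have hShat := gr20_Shat_sq D hD Pset V R γ tg hPmem hVmem xP hxP hPV hPcard hR y
    have hSR := gr20_SR_sq D hD V R hadd xP hR y
    have hSR' := gr20_SR_sq D hD V R hadd t₀ hR y
    rw [hRcard] at hSR hSR'
    push_cast at hSR hSR'
    set S := ∑ x ∈ Pset, signOf (D x) * twist x y with hSdef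
    set A := ∑ t ∈ R, signOf (D xP) * signOf (D (bxor xP t)) * twist t y with hAdef
    set A' := ∑ t ∈ R, signOf (D t₀) * signOf (D (bxor t₀ t)) * twist t y with hA'def
    -- `S ∈ {0, ±512}`, `A' ∈ {0, 128}`
    have hA : A = 0 ∨ A = 128 := by
      have h : A * (A - 128) = 0 := by nlinarith [hSR]
      rcases mul_eq_zero.1 h with h | h
      · exact Or.inl h
      · exact Or.inr (by linarith)
    have hS3 : ∃ s : ℤ, S = 512 * (s : ℝ) := by
      rcases hA with h | h
      · refine ⟨0, ?_⟩
        have h2 : S ^ 2 = 0 := by rw [hShat, h, mul_zero]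
        rw [pow_eq_zero_iff (by norm_num) |>.1 h2]; simp
      · have h2 : (S - 512) * (S + 512) = 0 := by
          have e2 : (S - 512) * (S + 512) = S ^ 2 - 2048 * 128 := by ring
          rw [e2, hShat, h]; ring
        rcases mul_eq_zero.1 h2 with h3 | h3
        · exact ⟨1, by push_cast; linarith⟩
        · exact ⟨-1, by push_cast; linarith⟩
    have hA3 : ∃ k : ℤ, A' = 128 * (k : ℝ) := by
      have h : A' * (A' - 128) = 0 := by nlinarith [hSR']
      rcases mul_eq_zero.1 h with h | h
      · exact ⟨0, by rw [h]; simp⟩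
      · exact ⟨1, by push_cast; linarith⟩
    have hst : ∃ σ : ℤ, signOf (D t₀) * twist t₀ y = (σ : ℝ) := by
      have hsg : signOf (D t₀) = 1 ∨ signOf (D t₀) = -1 := by cases D t₀ <;> simp [signOf]
      rcases hsg with h | h <;> rcases twist_eq_one_or t₀ y with h' | h' <;> rw [h, h']
      exacts [⟨1, by norm_num⟩, ⟨-1, by norm_num⟩, ⟨-1, by norm_num⟩, ⟨1, by norm_num⟩]
    -- `T̂(y) = σ(t₀)(−1)^{t₀·y}·A'`
    have hTsum : ∑ x ∈ (univ.filter fun x : Fin (6 + 6) → Bool => Odd (u' x) ∧ u' x - 2 * sZ (f x) = -3 * sZ (D x)), signOf (D x) * twist x y =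
        signOf (D t₀) * twist t₀ y * A' := by
      rw [hTeq, sum_image hinjt, hA'def, mul_sum]
      refine sum_congr rfl fun r _ => ?_
      rw [twist_bxor_left t₀ r y]
      have hsg : signOf (D t₀) = 1 ∨ signOf (D t₀) = -1 := by cases D t₀ <;> simp [signOf]
      rcases hsg with h | h <;> rw [h] <;> ring
    -- `ê(y) = Ŝ(y) − 4·T̂(y)`
    have hE : ∑ a, ((e a : ℤ) : ℝ) * twist a y = S - 4 * ∑ x ∈ (univ.filter fun x : Fin (6 + 6) → Bool => Odd (u' x) ∧ u' x - 2 * sZ (f x) = -3 * sZ (D x)), signOf (D x) * twist x y := by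
      have h1 : ∑ a, ((e a : ℤ) : ℝ) * twist a y = ∑ x ∈ Pset, ((e x : ℤ) : ℝ) * twist x y := by
        rw [← sum_filter_add_sum_filter_not univ (fun x : Fin (6 + 6) → Bool => Odd (u' x))]
        have hz : ∑ x ∈ univ.filter (fun x : Fin (6 + 6) → Bool => ¬ Odd (u' x)), ((e x : ℤ) : ℝ) * twist x y = 0 :=
          sum_eq_zero fun x hx => by
            have h := hoff x (mem_filter.1 hx).2
            have h0' : e x = 0 := by simp only [e]; omega
            rw [h0']; simp
        rw [hz, add_zero]
      have h2 : ∀ x ∈ Pset, ((e x : ℤ) : ℝ) * twist x y =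
          signOf (D x) * twist x y - 4 * (if x ∈ (univ.filter fun x : Fin (6 + 6) → Bool => Odd (u' x) ∧ u' x - 2 * sZ (f x) = -3 * sZ (D x)) then signOf (D x) * twist x y else 0) := by
        intro x hx
        have hx' : Odd (u' x) := (mem_filter.1 hx).2
        rcases hvals x hx' with h | h
        · have hnot : x ∉ (univ.filter fun x : Fin (6 + 6) → Bool => Odd (u' x) ∧ u' x - 2 * sZ (f x) = -3 * sZ (D x)) := by
            rw [mem_filter]
            rintro ⟨-, -, h'⟩
            have hsz : sZ (D x) = 1 ∨ sZ (D x) = -1 := by cases D x <;> simp [sZ]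
            rcases hsz with hs | hs <;> rw [hs] at h h' <;> omega
          rw [if_neg hnot]
          have h1 : ((e x : ℤ) : ℝ) = signOf (D x) := by
            rw [show e x = sZ (D x) from h, tp_sZ_cast]
          rw [h1]; ring
        · have hmem : x ∈ (univ.filter fun x : Fin (6 + 6) → Bool => Odd (u' x) ∧ u' x - 2 * sZ (f x) = -3 * sZ (D x)) := mem_filter.2 ⟨mem_univ _, hx', h⟩
          rw [if_pos hmem]
          have h1 : ((e x : ℤ) : ℝ) = -3 * signOf (D x) := by
            rw [show e x = -3 * sZ (D x) from h]; push_cast; rw [tp_sZ_cast]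
          rw [h1]; ring
      have hPT : Pset.filter (fun x => x ∈ (univ.filter fun x : Fin (6 + 6) → Bool => Odd (u' x) ∧ u' x - 2 * sZ (f x) = -3 * sZ (D x))) = (univ.filter fun x : Fin (6 + 6) → Bool => Odd (u' x) ∧ u' x - 2 * sZ (f x) = -3 * sZ (D x)) := by
        ext x
        rw [hPset]
        simp only [mem_filter, mem_univ, true_and]
        tauto
      rw [h1, sum_congr rfl h2, sum_sub_distrib, ← mul_sum, ← sum_filter, hPT]
    obtain ⟨s, hs⟩ := hS3
    obtain ⟨k, hk⟩ := hA3
    obtain ⟨σ, hσ⟩ := hst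
    refine ⟨s - σ * k, ?_⟩
    rw [hE, hTsum, hs, hσ, hk]
    push_cast
    ring
  -- duality: `e_f = −ê/64 ∈ 8ℤ`
  obtain ⟨-, ⟨uf, huf⟩⟩ := tw23_ge2932_levelFive f g hf hg hΦ
  have h8 : ∀ y, ∃ m : ℤ, uf y - 2 * sZ (g y) = 8 * m := by
    intro y
    obtain ⟨m, hm⟩ := key y
    have hd := l5k_duality f g u' hu' uf huf y
    have h1 : (-64 : ℝ) * (((uf y - 2 * sZ (g y) : ℤ) : ℝ)) = 512 * (m : ℝ) := by rw [← hd]; exact hm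
    refine ⟨-m, ?_⟩
    have h2 : (((uf y - 2 * sZ (g y) : ℤ) : ℝ)) = (((8 * (-m) : ℤ) : ℝ)) := by push_cast at h1 ⊢; linarith
    exact_mod_cast h2
  -- Parseval for `W_f = 32·u_f`: `Σ u_f² = 2¹⁴`
  have hpar := sum_W_sq (fun x => signOf (f x))
  simp_rw [huf] at hpar
  have hsq : ∑ x : Fin (6 + 6) → Bool, signOf (f x) ^ 2 = 4096 := by
    simp_rw [signOf_sq]
    rw [sum_const, card_univ, Fintype.card_fun, Fintype.card_bool, Fintype.card_fin]
    norm_num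
  rw [hsq] at hpar
  have hU : ((∑ y : Fin (6 + 6) → Bool, uf y ^ 2 : ℤ) : ℝ) = 16384 := by
    have h1 : ∑ y : Fin (6 + 6) → Bool, ((2 : ℝ) ^ 5 * (uf y : ℝ)) ^ 2 = 1024 * ∑ y : Fin (6 + 6) → Bool, (uf y : ℝ) ^ 2 := by
      rw [mul_sum]; exact sum_congr rfl fun y _ => by ring
    rw [h1] at hpar
    push_cast
    norm_num at hpar ⊢
    linarith
  -- termwise: `u_f = 8m + 2s_g`, `u_f² ≥ 4` with equality iff `m = 0`
  have hterm : ∀ y, 4 ≤ uf y ^ 2 ∧ (uf y ^ 2 = 4 → uf y - 2 * sZ (g y) = 0) := by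
    intro y
    obtain ⟨m, hm⟩ := h8 y
    have hs : sZ (g y) = 1 ∨ sZ (g y) = -1 := by cases g y <;> simp [sZ]
    have huf' : uf y = 8 * m + 2 * sZ (g y) := by linarith
    have hs2 : sZ (g y) ^ 2 = 1 := by rcases hs with h | h <;> rw [h] <;> norm_num
    have hprod : 0 ≤ m * (2 * m + sZ (g y)) := by
      rcases lt_trichotomy m 0 with hm0 | hm0 | hm0
      · have h2 : 2 * m + sZ (g y) ≤ 0 := by rcases hs with h | h <;> rw [h] <;> omega
        nlinarith
      · rw [hm0]; simp
      · have h2 : 0 ≤ 2 * m + sZ (g y) := by rcases hs with h | h <;> rw [h] <;> omega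
        nlinarith
    refine ⟨?_, fun h4 => ?_⟩
    · rw [huf']; nlinarith [hprod, hs2]
    · rw [huf'] at h4
      have hm0 : m * (2 * m + sZ (g y)) = 0 := by nlinarith [h4, hs2]
      rcases mul_eq_zero.1 hm0 with h0' | h0'
      · rw [hm, h0', mul_zero]
      · rcases hs with h | h <;> rw [h] at h0' <;> omega
  have hall : ∀ y, uf y ^ 2 = 4 := by
    have hsumZ : ∑ y : Fin (6 + 6) → Bool, (4 : ℤ) = ∑ y : Fin (6 + 6) → Bool, uf y ^ 2 := by
      have h1 : (∑ y : Fin (6 + 6) → Bool, uf y ^ 2 : ℤ) = 16384 := by exact_mod_cast hU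
      rw [h1, sum_const, card_univ, Fintype.card_fun, Fintype.card_bool, Fintype.card_fin]
      norm_num
    have h := (sum_eq_sum_iff_of_le (fun y _ => (hterm y).1)).1 hsumZ
    exact fun y => (h y (mem_univ _)).symm
  have hef0 : ∀ y, uf y - 2 * sZ (g y) = 0 := fun y => (hterm y).2 (hall y)
  -- hence `ê ≡ 0` and `e ≡ 0` by Walsh inversion — but `e² ≥ 1` on the odd set
  have hE0 : ∀ y, W (fun a => ((e a : ℤ) : ℝ)) y = 0 := by
    intro y
    have hd := l5k_duality f g u' hu' uf huf y
    rw [hef0 y] at hd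
    simp only [Int.cast_zero, mul_zero] at hd
    unfold W
    exact hd
  have hinv := tz_inversion (fun a => ((e a : ℤ) : ℝ)) xP
  simp_rw [hE0] at hinv
  simp only [zero_mul, sum_const_zero] at hinv
  have he0 : ((e xP : ℤ) : ℝ) = 0 := by
    have h : (2 : ℝ) ^ (6 + 6) ≠ 0 := by positivity
    exact (mul_eq_zero.1 hinv.symm).resolve_left h
  have h1 := hP1 xP ((mem_filter.1 hxP).2)
  have he0' : e xP = 0 := by exact_mod_cast he0
  have : u' xP - 2 * sZ (f xP) = 0 := he0'
  rw [this] at h1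
  norm_num at h1

/-! ### A level-5 side at `Φ ≥ 29/32` is in configuration (c) -/

/-- **Shape of a level-5 side at `Φ ≥ 29/32` (12 bits).**  For cubic `f, g` with `W_g = 32u'`, some `u'(x)` odd and `Φ(f,g) ≥ 29/32`,
the residual `e = u' − 2(−1)^f` is NOT supported on the odd hyperplane (`tw23_levelFive_R1_false`), and then it is in configuration (c)
of `tw23_levelFive_ge2932_offP`: `e/2` is odd at some even point (`tw23_levelFive_ge2932_offP_c`; by `l5t_layer2`, `e = ±2` on a
256-point subset of the even set with even 4-flat sections, `±1` on the odd set, `0` elsewhere).  Whether such pairs exist — i.e. whether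
`29/32` is a value at `n = 12` — remains OPEN.  NOT summit progress. [this work] -/
theorem tw23_levelFive_ge2932_shape (f g : (Fin (6 + 6) → Bool) → Bool) (hf : IsDegLeFun 3 f) (hg : IsDegLeFun 3 g)
    (u' : (Fin (6 + 6) → Bool) → ℤ) (hu' : ∀ x, W (fun y => signOf (g y)) x = (2 : ℝ) ^ 5 * (u' x : ℝ))
    (hodd : ∃ x, Odd (u' x)) (hΦ : (29 / 32 : ℝ) ≤ forrelation f g) :
    ∃ x, ¬ Odd (u' x) ∧ Odd ((u' x - 2 * sZ (f x)) / 2) := by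
  by_cases hne : ∃ y, ¬ Odd (u' y) ∧ u' y ≠ 2 * sZ (f y)
  · exact tw23_levelFive_ge2932_offP_c f g hf hg u' hu' hodd hΦ hne
  · push Not at hne
    exact (tw23_levelFive_R1_false f g hf hg u' hu' hodd hΦ hne).elim

end Summit.QuantumAdvantage.QuantumAdvantage.Theorems.CubicForrelation.NearExactIsExact

end
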